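import Summits.QuantumAdvantage.QuantumAdvantage.Theorems.SosSandwichTransferPBMachineEncodings
import Literature.Computability.Cryptography.ExplicitKWiseHashFamily
import Literature.Computability.QuantumComplexity.BoundedIndependencePolynomials
import HarnessLib

/-!
# Crux `TransferPB` (stmt-QuantumAdvantage-15238, route SosSandwich), line `birth` — the MEAN node quantity over the explicit hashed completion

Obligation (Q)/(K) of the last stub `stub_pbOracleSimulation` asks for `nodeProblem F r c k ∈ PromiseBQP`
(`Theorems/SosSandwichTransferPBMachineDefs.lean`); its MEAN instances compare `nodeMean F x ρ = E_y[p_x|_ρ(y)]`, an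
average over the `2^M` completions `y` of the relevant oracle bits (`M = numOracleBits F x`, exponential), with
`j/40`. A quantum machine cannot sample `y`; it replaces `y` by a member of the EXPLICIT `k`-wise independent family
of `Literature/Computability/Cryptography/ExplicitKWiseHashFamily.lean` (`stdFamily k m key`, keys of
`keyPoly (k+m) = 6(k+m+1)²` bits, evaluated in `P`: `ExplicitKWiseHashMachine.hashLang_mem_P`). This file proves
that the replacement is EXACT for the mean:

* `famPoint_bitString` — the cube point read off an oracle along the relevant strings is the tree's `oracleBits`;
* **`nodeMean_eq_hashedAvg`** — for `k ≥ 2T` (`T` = number of oracle gates of `F.circ |x|`) and `m + 1 ≥` the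
  oracle width: `nodeMean F x ρ = 2^{-|key|} Σ_key Pr[F^{A_key ◁ ρ}(x) accepts]`, where `A_key ◁ ρ` is the oracle
  whose relevant bits are those of the hash `stdFamily k m key` overridden along the path `ρ`
  (`oracleOf F x (ρ.foldr update (oracleBits F x (stdFamily k m key)))`).

Proof: `p_x|_ρ` has total degree `≤ 2T ≤ k` (`totalDegree_restrictPath_le`, `totalDegree_acceptPoly_le`), the
relevant strings `bitString F x` are distinct and shorter than the width, so Zhandry's averaging identity in cube
form (`IsKWiseIndepFamily.keyAvg_evalBool_eq_boolAvg`, `Literature/…/BoundedIndependencePolynomials.lean`) applies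
to the `k`-wise independent family `isKWiseIndepFamily_stdFamily`; restriction is evaluation at the overridden
point (`evalBool_restrictPath`) and the acceptance polynomial evaluates to the acceptance probability
(`evalBool_acceptPoly`, `oracleBits_oracleOf`). What remains for MEAN instances is a uniform circuit whose acceptance
probability is the right-hand side (keys on Hadamard wires, the hash evaluated inside the circuit, `ρ` hard-wired).
Sources: M. Zhandry, CRYPTO 2012, Thm. 3.1; S. Aaronson, A. Ambainis, Theory Comput. 10 (2014), proof of Thm. 23.
-/

-- D-0017: single-conjunct summit ⇒ the duplicate `QuantumAdvantage.QuantumAdvantage` is mandated.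
set_option linter.dupNamespace false

noncomputable section

namespace Summit.QuantumAdvantage.QuantumAdvantage.Cruxes.TransferPB.Birth

open Finset Literature.Computability.Cryptography Literature.Computability.Complexity
  Literature.Computability.QuantumComplexity Literature.Computability.QuantumComplexity.ClassicalSimulation
  Literature.Computability.Cryptography.ExplicitKWiseHash

namespace SimTreePB

variable (F : QCircuitFamily cliffordT) (x : List Bool)

/-- The cube point read off an oracle along the relevant strings is the tree's `oracleBits`. [folklore] -/
theorem famPoint_bitString (A : Set (List Bool)) : famPoint (bitString F x) A = oracleBits F x A := by
  funext i
  rw [oracleBits, restrictBool_apply]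
  rfl

/-- The relevant strings are shorter than the width. [folklore] -/
theorem bitString_mem_shortStrings {m : ℕ} (hm : oracleWidth F x ≤ m + 1) (s : Fin (numOracleBits F x)) :
    bitString F x s ∈ shortStrings (m + 1) := by
  have h := ((bitEquiv F x).symm s).2
  rw [mem_shortStrings] at h ⊢
  exact lt_of_lt_of_le h hm

/-- **The MEAN node quantity over the explicit hashed completion is exact.** For `k ≥ 2T` and `m + 1 ≥` the oracle
width, `E_y[p_x|_ρ(y)]` equals the average over the `6(k+m+1)²`-bit keys of the acceptance probability of `F` at
`x` on the oracle whose relevant bits are the hash `stdFamily k m key` overridden along `ρ`.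
[cite: Zhandry2012IBE, Thm. 3.1] [cite: AaronsonAmbainis2014, Thm. 23 (proof, p. 14)] -/
theorem nodeMean_eq_hashedAvg (k m : ℕ) (hk : 2 * (F.circ x.length).oracleQueries ≤ k)
    (hm : oracleWidth F x ≤ m + 1) (ρ : List (Fin (numOracleBits F x) × Bool)) :
    nodeMean F x ρ =
      (∑ key : Fin (keyPoly.eval (k + m)) → Bool,
        F.acceptProbOn (oracleOf F x (ρ.foldr (fun ib z => Function.update z ib.1 ib.2)
          (oracleBits F x (stdFamily k m key)))) x) / 2 ^ keyPoly.eval (k + m) := by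
  have hdeg : (restrictPath ρ (acceptPoly F x)).totalDegree ≤ k :=
    (totalDegree_restrictPath_le ρ _).trans ((totalDegree_acceptPoly_le F x).trans hk)
  have havg := (isKWiseIndepFamily_stdFamily k m).keyAvg_evalBool_eq_boolAvg (bitString_injective F x)
    (bitString_mem_shortStrings F x hm) (restrictPath ρ (acceptPoly F x)) hdeg
  rw [nodeMean, ← havg, Fintype.card_pi, Finset.prod_const, Fintype.card_bool, Finset.card_univ,
    Fintype.card_fin]
  push_cast
  congr 1
  refine Finset.sum_congr rfl fun key _ => ?_
  rw [evalBool_restrictPath, famPoint_bitString, ← evalBool_acceptPoly F x,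
    oracleBits_oracleOf]

end SimTreePB

end Summit.QuantumAdvantage.QuantumAdvantage.Cruxes.TransferPB.Birth

end
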